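import Literature.Analysis.FluidPDE.DissipationWavenumber
import Literature.Analysis.FluidPDE.CheskidovShvydkoyDyadicEnergy
import Literature.Analysis.FluidPDE.BlockLipschitz
import HarnessLib

/-!
# The cut at the dissipation wavenumber: top saturated level, low-mode factor, occupation split

Analysis/FluidPDE support file (serves the discharge of the named fact
`Literature.Analysis.FluidPDE.cheskidov_dai_occupation_regular` — Cheskidov–Dai, arXiv:1507.06611 =
Proc. Edinburgh Math. Soc. (2025), Thm. 1.1). With `Λ(t) = λ_{Q(t)}` the dissipation wavenumber
(tree: `dissipationWavenumber c ν`, `IsSaturatedLevel`), §3.1 of the paper uses three facts about the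
low-mode factor `f(t) = ∑_{q ≤ Q(t)} λ_q ‖u_q‖_∞`:

* the levels above the cut are unsaturated: `λ_p⁻¹ ‖u_p‖_∞ < c ν` for `p > Q` — here `exists_topLevel`,
  `blockSup_le_of_topLevel` (the top saturated level `J` of a slice with `Λ < ∞`, through
  `Nat.findGreatest`, and `‖Δ̇_l v‖_∞ ≤ c ν 2^l` for every integer `l > J`);
* the split `f = f_{≤q*} + f_{>q*}` with `f_{≤q*} ≤ M_{q*}` by "Bernstein's and energy inequalities" and
  `f_{>q*}(t) = ∑_{q* < q ≤ Q(t)} λ_q ‖u_q‖_∞`, each term being the OCCUPATION integrand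
  `1_{q ≤ Q(τ)} λ_q ‖u_q‖_∞` of the hypothesis of Thm. 1.1 — here `lowSum_le_const_add_sum_occupation`;
* the bound on the cut by the energy at the scale of the estimate, (3.9):
  `c_r ν Λ^{ε} ≲ ‖u‖_{H^s}`, `ε = s - 1/2` — here, at `s = 1`, `sq_mul_two_pow_topLevel_le`:
  `(cν)² 2^J ≤ 400 C_∞² F(v)` from the saturation of the top level and Bernstein on the window
  `Δ̇_J v = Δ̇_J ∑_{|l-J|≤2} Δ̇_l v` (`BlockLipschitz.blockFn_sum_window_eq`).

All slices here are smooth `L²` fields on `ℝ^ι`; constants from `LPBounds`.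

## References

* A. Cheskidov, M. Dai, arXiv:1507.06611 = Proc. Edinburgh Math. Soc. (2025), §3 (definition of `Λ`,
  `f`), §3.1 (3.9) and the split `f = f_{≤q*} + f_{>q*}`. [CheskidovDai2015]
-/

noncomputable section

open MeasureTheory Filter Topology Function Set
open Literature.Analysis.FunctionSpaces
open scoped ENNReal NNReal RealInnerProductSpace

namespace Literature.Analysis.FluidPDE

section Cut

variable {ι : Type*} [Fintype ι]

/-- **The top saturated level.** If the dissipation wavenumber of a slice is finite, there is a level
`J ∈ ℕ` above which no level is saturated and which is itself saturated unless `J = 0`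
(`Λ = 2^J`, resp. `Λ = 1`; Cheskidov–Dai §3: `λ_{Q(t)} = Λ(t)`). [cite: CheskidovDai2015, §3 (definition of Λ and Q)] -/
theorem exists_topLevel {c ν : ℝ} {v : EuclideanSpace ℝ ι → EuclideanSpace ℝ ι}
    (h : dissipationWavenumber c ν v < ∞) :
    ∃ J : ℕ, (∀ j : ℕ, J < j → ¬ IsSaturatedLevel c ν v j) ∧ (J = 0 ∨ IsSaturatedLevel c ν v J) := by
  classical
  obtain ⟨n, hn⟩ := (dissipationWavenumber_lt_top_iff c ν v).1 h
  refine ⟨Nat.findGreatest (fun j => IsSaturatedLevel c ν v j) n, fun j hj => ?_, ?_⟩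
  · by_cases hjn : j ≤ n
    · exact Nat.findGreatest_is_greatest hj hjn
    · exact hn j (not_le.1 hjn)
  · by_cases h0 : Nat.findGreatest (fun j => IsSaturatedLevel c ν v j) n = 0
    · exact Or.inl h0
    · exact Or.inr (Nat.findGreatest_of_ne_zero rfl h0)

/-- **Above the top level the blocks are unsaturated**: `‖Δ̇_l v‖_∞ ≤ c ν 2^l` for every integer
`l > J` (Cheskidov–Dai §3: "`‖u_p(t)‖_∞ < λ_p c_r ν` for all `p > Q(t)`"). [cite: CheskidovDai2015, §3 (definition of Λ)] -/
theorem blockSup_le_of_topLevel {c ν : ℝ} {v : EuclideanSpace ℝ ι → EuclideanSpace ℝ ι} {J : ℕ}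
    (hJ : ∀ j : ℕ, J < j → ¬ IsSaturatedLevel c ν v j) (l : ℤ) (hl : (J : ℤ) < l) :
    blockSup v l ≤ ENNReal.ofReal (c * ν) * (2 : ℝ≥0∞) ^ l := by
  have hl0 : 0 ≤ l := by omega
  obtain ⟨n, rfl⟩ := Int.eq_ofNat_of_zero_le hl0
  have hn : J < n := by exact_mod_cast hl
  have h := hJ n hn
  rw [isSaturatedLevel_iff, not_le] at h
  rw [zpow_natCast]
  exact h.le

/-- **Every level up to the top level lies below the dissipation wavenumber**: `2^q ≤ Λ(v)` for
`q ≤ J` (so the occupation indicator `1_{q ≤ Q}` equals `1` there). [cite: CheskidovDai2015, §3 (definition of Λ and Q)] -/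
theorem two_pow_le_dissipationWavenumber_of_le_topLevel {c ν : ℝ} {v : EuclideanSpace ℝ ι → EuclideanSpace ℝ ι} {J : ℕ}
    (hJ : J = 0 ∨ IsSaturatedLevel c ν v J) {q : ℕ} (hq : q ≤ J) :
    (2 : ℝ≥0∞) ^ q ≤ dissipationWavenumber c ν v := by
  rcases hJ with hJ0 | hJs
  · subst hJ0
    have : q = 0 := Nat.le_zero.1 hq
    subst this
    rw [pow_zero]; exact one_le_dissipationWavenumber _ _ _
  · exact (pow_le_pow_right₀ one_le_two hq).trans (two_pow_le_dissipationWavenumber hJs)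

/-- **The canonical top level** `J(v) = sup {j ∈ ℕ : level j saturated}` (a choice-free version of
`exists_topLevel`, so that a.e.-equal slices have the same cut): if the dissipation wavenumber is finite,
`J(v)` is a top level. [cite: CheskidovDai2015, §3 (definition of Λ and Q)] -/
theorem topLevel_sSup {c ν : ℝ} {v : EuclideanSpace ℝ ι → EuclideanSpace ℝ ι}
    (h : dissipationWavenumber c ν v < ∞) :
    (∀ j : ℕ, sSup {j : ℕ | IsSaturatedLevel c ν v j} < j → ¬ IsSaturatedLevel c ν v j) ∧
      (sSup {j : ℕ | IsSaturatedLevel c ν v j} = 0 ∨ IsSaturatedLevel c ν v (sSup {j : ℕ | IsSaturatedLevel c ν v j})) := by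
  obtain ⟨n, hn⟩ := (dissipationWavenumber_lt_top_iff c ν v).1 h
  set S : Set ℕ := {j : ℕ | IsSaturatedLevel c ν v j} with hS
  have hbdd : BddAbove S := ⟨n, fun j hj => not_lt.1 fun hnj => hn j hnj hj⟩
  refine ⟨fun j hj hsat => ?_, ?_⟩
  · exact (not_le.2 hj) (le_csSup hbdd hsat)
  · by_cases hne : S.Nonempty
    · exact Or.inr (Nat.sSup_mem hne hbdd)
    · left
      rw [Set.not_nonempty_iff_eq_empty] at hne
      rw [hne, csSup_empty]
      rfl

/-- The saturation predicate, hence the canonical top level, only depends on the a.e. class of the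
slice. [cite: CheskidovDai2015, §3 (definition of Λ)] -/
theorem isSaturatedLevel_congr_ae {c ν : ℝ} {v w : EuclideanSpace ℝ ι → EuclideanSpace ℝ ι}
    (h : v =ᵐ[volume] w) (j : ℕ) : IsSaturatedLevel c ν v j ↔ IsSaturatedLevel c ν w j := by
  rw [isSaturatedLevel_iff, isSaturatedLevel_iff, blockFn_congr_ae (j : ℤ) h]

/-- The dissipation wavenumber only depends on the a.e. class of the slice. [cite: CheskidovDai2015, §3 (definition of Λ)] -/
theorem dissipationWavenumber_congr_ae {c ν : ℝ} {v w : EuclideanSpace ℝ ι → EuclideanSpace ℝ ι}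
    (h : v =ᵐ[volume] w) : dissipationWavenumber c ν v = dissipationWavenumber c ν w := by
  unfold dissipationWavenumber
  simp_rw [isSaturatedLevel_congr_ae h]

variable (K : LPBounds ι)

/-- **The low-mode factor below a fixed level is bounded by the energy** (Cheskidov–Dai §3.1:
"Thanks to Bernstein's and energy inequalities, `f_{≤q*}(t) ≤ M_{q*}`"):
`∑_{n ≥ 0} 2^{q*-n} ‖Δ̇_{q*-n} v‖_∞ ≤ 2^{q*} C_∞ ‖v‖₂ 2^{q* d/2} G_d`. [cite: CheskidovDai2015, §3.1 (bound on f_{≤q*})] -/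
theorem lowSum_le_of_eLpNorm_le {v : EuclideanSpace ℝ ι → EuclideanSpace ℝ ι} (hv : MemLp v 2 volume) (q : ℤ) :
    ∑' n : ℕ, (2 : ℝ≥0∞) ^ (q - n) * blockSup v (q - n) ≤
      (2 : ℝ≥0∞) ^ q * (K.Cinf * eLpNorm v 2 volume * (2 : ℝ≥0∞) ^ (((q + 1 - 1 : ℤ) : ℝ) * Fintype.card ι * 2⁻¹) * LPBounds.geomDim ι) := by
  have hle : ∀ n : ℕ, (2 : ℝ≥0∞) ^ (q - n) * blockSup v (q - n) ≤ (2 : ℝ≥0∞) ^ q * blockSup v (q + 1 - 1 - n) := by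
    intro n
    rw [show q + 1 - 1 - (n : ℤ) = q - n by ring]
    exact mul_le_mul_left (ENNReal.zpow_le_of_le (by norm_num) (by omega)) _
  refine (ENNReal.tsum_le_tsum hle).trans ?_
  rw [ENNReal.tsum_mul_left]
  gcongr
  exact K.tsum_blockSup_low_le hv (q + 1)

/-- **The split of the low-mode factor at a fixed level `q*`** (Cheskidov–Dai §3.1,
`f = f_{≤q*} + f_{>q*}`, `f_{>q*}(t) = 1_{q*<Q(t)} ∑_{q*<q≤Q(t)} λ_q ‖u_q‖_∞`): for the top level `J` of a
slice and any `Q_b ≥ J`,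
`∑_{n≥0} 2^{J-n} s_{J-n} ≤ ∑_{n≥0} 2^{q*-n} s_{q*-n} + ∑_{q ∈ (q*, Q_b]} 1_{2^q ≤ Λ(v)} 2^q s_q`, every
level `q ≤ J` lying below `Λ` (`two_pow_le_dissipationWavenumber_of_le_topLevel`).
[cite: CheskidovDai2015, §3.1 (split of f)] -/
theorem lowSum_le_lowSum_add_sum_occupation {c ν : ℝ} {v : EuclideanSpace ℝ ι → EuclideanSpace ℝ ι} {J : ℕ}
    (hJ : J = 0 ∨ IsSaturatedLevel c ν v J) (qs Qb : ℕ) (hQb : J ≤ Qb) :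
    ∑' n : ℕ, (2 : ℝ≥0∞) ^ ((J : ℤ) - n) * blockSup v ((J : ℤ) - n) ≤
      (∑' n : ℕ, (2 : ℝ≥0∞) ^ ((qs : ℤ) - n) * blockSup v ((qs : ℤ) - n)) +
        ∑ q ∈ Finset.Ioc qs Qb, {w : EuclideanSpace ℝ ι → EuclideanSpace ℝ ι | (2 : ℝ≥0∞) ^ q ≤ dissipationWavenumber c ν w}.indicator
          (fun w => (2 : ℝ≥0∞) ^ q * eLpNorm (blockFn (q : ℤ) w) ∞ volume) v := by
  set t : ℤ → ℝ≥0∞ := fun l => (2 : ℝ≥0∞) ^ l * blockSup v l with ht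
  -- the indicator equals the full term for `q ≤ J`
  have hind : ∀ q : ℕ, q ≤ J → {w : EuclideanSpace ℝ ι → EuclideanSpace ℝ ι | (2 : ℝ≥0∞) ^ q ≤ dissipationWavenumber c ν w}.indicator
      (fun w => (2 : ℝ≥0∞) ^ q * eLpNorm (blockFn (q : ℤ) w) ∞ volume) v = t q := by
    intro q hq
    rw [indicator_of_mem (show v ∈ {w : EuclideanSpace ℝ ι → EuclideanSpace ℝ ι | (2 : ℝ≥0∞) ^ q ≤ dissipationWavenumber c ν w} from
      two_pow_le_dissipationWavenumber_of_le_topLevel hJ hq)]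
    simp only [ht, blockSup, zpow_natCast]
  by_cases hqJ : J ≤ qs
  · -- everything is below `q*`: the left sum is a tail of the right one
    have hk : ∀ n : ℕ, t ((J : ℤ) - n) = (fun m : ℕ => t ((qs : ℤ) - m)) (n + (qs - J)) := by
      intro n; simp only; congr 1; push_cast [Nat.cast_sub hqJ]; ring
    calc ∑' n : ℕ, t ((J : ℤ) - n) = ∑' n : ℕ, (fun m : ℕ => t ((qs : ℤ) - m)) (n + (qs - J)) := tsum_congr hk
      _ ≤ ∑' m : ℕ, t ((qs : ℤ) - m) := by
          rw [← Summable.sum_add_tsum_nat_add' (f := fun m : ℕ => t ((qs : ℤ) - m)) (k := qs - J) ENNReal.summable]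
          exact le_add_self
      _ ≤ _ := le_self_add
  · push Not at hqJ
    -- split the left sum at `n = J - q*`
    rw [← Summable.sum_add_tsum_nat_add' (f := fun n : ℕ => t ((J : ℤ) - n)) (k := J - qs) ENNReal.summable]
    rw [add_comm]
    refine add_le_add ?_ ?_
    · -- the tail is the low sum at `q*`
      refine le_of_eq (tsum_congr fun n => ?_)
      simp only [ht]
      congr 1 <;> push_cast [Nat.cast_sub hqJ.le] <;> ring
    · -- the head is the occupation sum over `(q*, J] ⊆ (q*, Q_b]`
      calc ∑ i ∈ Finset.range (J - qs), t ((J : ℤ) - i)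
          = ∑ q ∈ Finset.Ioc qs J, t q := by
            refine Finset.sum_nbij' (fun i => J - i) (fun q => J - q) ?_ ?_ ?_ ?_ ?_
            · intro i hi; simp only [Finset.mem_range] at hi; simp only [Finset.mem_Ioc]; omega
            · intro q hq; simp only [Finset.mem_Ioc] at hq; simp only [Finset.mem_range]; omega
            · intro i hi; simp only [Finset.mem_range] at hi; omega
            · intro q hq; simp only [Finset.mem_Ioc] at hq; omega
            · intro i hi; simp only [Finset.mem_range] at hi; congr 1; push_cast [Nat.cast_sub (show i ≤ J by omega)]; ring
        _ = ∑ q ∈ Finset.Ioc qs J, {w : EuclideanSpace ℝ ι → EuclideanSpace ℝ ι | (2 : ℝ≥0∞) ^ q ≤ dissipationWavenumber c ν w}.indicator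
              (fun w => (2 : ℝ≥0∞) ^ q * eLpNorm (blockFn (q : ℤ) w) ∞ volume) v :=
            Finset.sum_congr rfl fun q hq => (hind q (Finset.mem_Ioc.1 hq).2).symm
        _ ≤ _ := Finset.sum_le_sum_of_subset_of_nonneg (Finset.Ioc_subset_Ioc_right hQb) fun _ _ _ => bot_le

/-- **The top level is controlled by the enstrophy** (Cheskidov–Dai (3.9) at `s = 1`:
`c_r ν Λ^{1/2} ≲ Λ^{1} ‖u_Q‖₂ ≲ ‖u‖_{H¹}`): if the level `J` of a smooth `L²` field `v` on `ℝ^ι` is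
saturated, then `c ν 2^J ≤ 20 C_∞ 2^{J d/2} 2^{-J} F(v)^{1/2}` — saturation `c ν 2^J ≤ ‖Δ̇_J v‖_∞`, the
window identity `Δ̇_J v = Δ̇_J ∑_{|l-J|≤2} Δ̇_l v` (`blockFn_sum_window_eq`), Bernstein `L² → L^∞` and
`2^l ‖Δ̇_l v‖₂ ≤ F^{1/2}`. [cite: CheskidovDai2015, §3.1 (3.9)] -/
theorem ofReal_mul_two_pow_le_of_isSaturatedLevel [Nonempty ι] {c ν : ℝ} {v : EuclideanSpace ℝ ι → EuclideanSpace ℝ ι}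
    (hv : IsSmoothL2Field v) {J : ℕ} (hJ : IsSaturatedLevel c ν v J) :
    ENNReal.ofReal (c * ν) * (2 : ℝ≥0∞) ^ J ≤
      20 * (K.Cinf * (2 : ℝ≥0∞) ^ (((J : ℤ) : ℝ) * Module.finrank ℝ (EuclideanSpace ℝ ι) * 2⁻¹) *
        ((2 : ℝ≥0∞) ^ (-(J : ℤ)) * dyadicF v ^ (1 / 2 : ℝ))) := by
  haveI : Fact (1 ≤ (2 : ℝ≥0∞)) := ⟨one_le_two⟩
  have h2ne : (2 : ℝ≥0∞) ≠ 0 := two_ne_zero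
  have h2top : (2 : ℝ≥0∞) ≠ ∞ := ENNReal.ofNat_ne_top
  have hv2 := hv.memLp_two
  set W : EuclideanSpace ℝ ι → EuclideanSpace ℝ ι := ∑ l ∈ Finset.Icc ((J : ℤ) - 2) ((J : ℤ) + 2), blockFn l v with hW
  have hbl : ∀ l, MemLp (blockFn l v) 2 volume := fun l => memLp_blockFn l hv2 one_le_two
  have hW2 : MemLp W 2 volume := memLp_finsetSum' _ fun l _ => hbl l
  -- saturation and the window identity
  have h1 : ENNReal.ofReal (c * ν) * (2 : ℝ≥0∞) ^ J ≤ eLpNorm (blockFn (J : ℤ) W) ∞ volume := by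
    rw [hW, blockFn_sum_window_eq (J : ℤ) hv]; exact hJ
  -- Bernstein `L² → L^∞` on the window and the triangle inequality
  have h2 : eLpNorm (blockFn (J : ℤ) W) ∞ volume ≤
      K.Cinf * (2 : ℝ≥0∞) ^ (((J : ℤ) : ℝ) * Module.finrank ℝ (EuclideanSpace ℝ ι) * 2⁻¹) * eLpNorm W 2 volume :=
    K.sup_le (J : ℤ) W hW2
  have h3 : eLpNorm W 2 volume ≤ ∑ l ∈ Finset.Icc ((J : ℤ) - 2) ((J : ℤ) + 2), blockL2 v l := by
    rw [hW]
    refine (eLpNorm_sum_le (fun l _ => (hbl l).1) one_le_two).trans (le_of_eq ?_)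
    rfl
  -- each block of the window against `F^{1/2}`
  have h4 : ∀ l ∈ Finset.Icc ((J : ℤ) - 2) ((J : ℤ) + 2), blockL2 v l ≤ 4 * ((2 : ℝ≥0∞) ^ (-(J : ℤ)) * dyadicF v ^ (1 / 2 : ℝ)) := by
    intro l hl
    simp only [Finset.mem_Icc] at hl
    have hF := two_zpow_mul_le_sqrt_dyadicSqSum (blockL2 v) l
    have hinv : blockL2 v l = (2 : ℝ≥0∞) ^ (-l) * ((2 : ℝ≥0∞) ^ l * blockL2 v l) := by
      rw [← mul_assoc, ← ENNReal.zpow_add h2ne h2top, neg_add_cancel, zpow_zero, one_mul]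
    rw [hinv]
    calc (2 : ℝ≥0∞) ^ (-l) * ((2 : ℝ≥0∞) ^ l * blockL2 v l) ≤ (2 : ℝ≥0∞) ^ (2 + -(J : ℤ)) * dyadicF v ^ (1 / 2 : ℝ) :=
          mul_le_mul' (ENNReal.zpow_le_of_le (by norm_num) (by omega)) hF
      _ = 4 * ((2 : ℝ≥0∞) ^ (-(J : ℤ)) * dyadicF v ^ (1 / 2 : ℝ)) := by
          rw [ENNReal.zpow_add h2ne h2top, show (2 : ℤ) = (2 : ℕ) by rfl, zpow_natCast]; norm_num; ring
  have h5 : ∑ l ∈ Finset.Icc ((J : ℤ) - 2) ((J : ℤ) + 2), blockL2 v l ≤ 20 * ((2 : ℝ≥0∞) ^ (-(J : ℤ)) * dyadicF v ^ (1 / 2 : ℝ)) := by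
    calc ∑ l ∈ Finset.Icc ((J : ℤ) - 2) ((J : ℤ) + 2), blockL2 v l
        ≤ ∑ _l ∈ Finset.Icc ((J : ℤ) - 2) ((J : ℤ) + 2), 4 * ((2 : ℝ≥0∞) ^ (-(J : ℤ)) * dyadicF v ^ (1 / 2 : ℝ)) :=
          Finset.sum_le_sum h4
      _ = 20 * ((2 : ℝ≥0∞) ^ (-(J : ℤ)) * dyadicF v ^ (1 / 2 : ℝ)) := by
          rw [Finset.sum_const, Int.card_Icc, show Int.toNat ((J : ℤ) + 2 + 1 - ((J : ℤ) - 2)) = 5 by omega, nsmul_eq_mul]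
          push_cast; ring
  calc ENNReal.ofReal (c * ν) * (2 : ℝ≥0∞) ^ J ≤ eLpNorm (blockFn (J : ℤ) W) ∞ volume := h1
    _ ≤ K.Cinf * (2 : ℝ≥0∞) ^ (((J : ℤ) : ℝ) * Module.finrank ℝ (EuclideanSpace ℝ ι) * 2⁻¹) * eLpNorm W 2 volume := h2
    _ ≤ K.Cinf * (2 : ℝ≥0∞) ^ (((J : ℤ) : ℝ) * Module.finrank ℝ (EuclideanSpace ℝ ι) * 2⁻¹) *
        (20 * ((2 : ℝ≥0∞) ^ (-(J : ℤ)) * dyadicF v ^ (1 / 2 : ℝ))) := by gcongr; exact h3.trans h5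
    _ = _ := by ring

end Cut

end Literature.Analysis.FluidPDE

end
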